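import Mathlib.Data.Complex.Basic
import Mathlib.Logic.Equiv.Fin.Basic
import Mathlib.Tactic
import HarnessLib

/-!
# Limits of discrete series of the real unitary groups `U(p,q)`: Harish-Chandra data,
# non-vanishing and (non-)degeneracy (Knapp–Zuckerman)

Let `G = U(p,q)` (connected, real rank `min p q`, compact centre), `K = U(p) × U(q)`, and
`T = U(1)^{p+q} ⊆ K` the diagonal compact Cartan subgroup. We index the coordinates of
`𝔱* ≅ ℚ^{p+q}` (rational coordinates suffice: all parameters below are half-integers) by
`Fin p ⊕ Fin q`: `Sum.inl i ↔ e_i` (the `U(p)`-block) and `Sum.inr j ↔ f_j` (the `U(q)`-block).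
The roots of `(𝔤_ℂ, 𝔱_ℂ) = (𝔤𝔩_{p+q}(ℂ), diagonal)` are the `e_x - e_y`, `x ≠ y`; such a root is
**compact** (a root of `K`) iff `x, y` lie in the same block and **noncompact** otherwise
(Carayol–Knapp 2007, Introduction: for `SU(2,1)`, `e₁ - e₂` is compact and `e₂ - e₃` noncompact).
All roots have the same length and `⟨λ, (e_x - e_y)^∨⟩ = λ_x - λ_y`, so "`λ` is orthogonal to
`e_x - e_y`" reads `λ_x = λ_y`. Positive systems `Ψ` (= Weyl chambers `C`) of type `A_{p+q-1}`
correspond to enumerations `σ : Fin (p+q) ≃ Fin p ⊕ Fin q` of the coordinates: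
`Ψ_σ = {e_{σ a} - e_{σ b} : a < b}`, with simple roots `e_{σ a} - e_{σ (a+1)}` and
`ρ_Ψ = ((p+q-1)/2, (p+q-3)/2, …)` along `σ`. The character lattice is `X*(T) = ℤ^{p+q}`, so
`λ + ρ_Ψ` (equivalently `λ - ρ_Ψ`) is analytically integral iff every `λ_x ∈ (p+q-1)/2 + ℤ`.

Following Knapp–Zuckerman (Ann. of Math. 116 (1982); we use the restatements in
Carayol–Knapp 2007 §2, Knapp–Vogan 1995 §XI.8 and Goldring–Koskivirta 2019 §2.2.2), to a pair
`(λ, Ψ)` with `λ` `Ψ`-dominant and `λ + ρ_Ψ` integral one attaches the representation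
`π(λ, Ψ)` (Zuckerman translation to `λ` of a discrete series with parameter in the open chamber),
which is zero or irreducible tempered, and:

* `π(λ, Ψ) = 0` iff `λ` is orthogonal to some **compact `Ψ`-simple** root
  (Carayol–Knapp 2007, (2.4) = Hecht–Schmid + Knapp–Zuckerman Thm 1.1(b); Knapp–Vogan 1995,
  Prop. 11.180) — `LDSDatum.IsNonzero`;
* `π(λ, Ψ)` is a discrete series iff `λ` is regular (Knapp–Vogan 1995, (11.184)/(11.190d)) —
  `LDSDatum.IsRegular`;
* a (nonzero) `π(λ, Ψ)` is **non-degenerate** iff `λ` is orthogonal to **no compact root at all**,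
  degenerate otherwise (Knapp–Zuckerman §12 "nondegenerate data", real-rank-zero case;
  Carayol–Knapp 2007, Introduction and §2; Goldring–Koskivirta 2019, §2.2.2; Goldring 2016,
  §3.5.3) — `LDSDatum.IsNondegenerate`, `LDSDatum.IsNondegenerateLimitOfDiscreteSeries`;
* `π(λ, Ψ) ≅ π(λ', Ψ')` (both nonzero) iff `(λ', Ψ') = w (λ, Ψ)` for some `w` in the compact Weyl
  group `W_K = S_p × S_q` (Knapp–Zuckerman Thm 1.1(c); Carayol–Knapp 2007, §2) —
  `LDSDatum.IsKConjugate`;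
* the infinitesimal character of `π(λ, Ψ)` is (the `S_{p+q}`-orbit of) `λ`
  (Knapp–Vogan 1995, (11.184d); Goldring 2016, Thm. 3.5.1) — `LDSDatum.infChar`, a
  `Multiset ℂ` of cardinality `p + q`, the format in which
  `Literature.NumberTheory.Automorphic.HasHCParameter` / `HasArchParameter` / `InfinityType`
  record Harish-Chandra parameters of `𝔤𝔩_{p+q}`-modules.

Non-degenerate limits of discrete series are exactly the archimedean components detected by the
coherent cohomology of Shimura varieties (Schmid, Williams, Harris; Goldring–Koskivirta 2019,
Thm. 2.2.1), which is why the routes `Langlands/QuadraticWindow`, `Langlands/DegenerateLimits`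
asked for this vocabulary.

## The `U(n,n)` parameters `(k | k)` (`LDSDatum.twinDatum`)

For `k₁ > … > k_n` in `1/2 + ℤ` the parameter `λ = (k₁,…,k_n | k₁,…,k_n)` of `U(n,n)` is
orthogonal exactly to the `n` noncompact roots `±(e_i - f_i)` (`twinDatum_param_eq_iff`), is
dominant for each of the `2^n` chambers `Ψ_ε` obtained by interleaving `e_i, f_i` in either order
(`twinOrder ε`, `ε : Fin n → Bool`; these are all the chambers whose closure contains `λ`, the
stabiliser of `λ` in `W = S_{2n}` being generated by the `n` commuting transpositions `e_i ↔ f_i` —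
not formalised here), and each `π(λ, Ψ_ε)` is a NON-DEGENERATE limit of discrete series
(`isNondegenerateLimitOfDiscreteSeries_twinDatum`), a proper limit as soon as `n ≥ 1`
(`not_isRegular_twinDatum`). Conversely no discrete series or limit of discrete series of any
`U(p,q)` with `p + q` even has an integral coordinate in its Harish-Chandra parameter
(`LDSDatum.param_ne_intCast`): the parity dichotomy used by route `Langlands/QuadraticWindow`
(crux `SignLaw`).

## What is NOT here

No representation theory of `U(p,q)` is formalised: `LDSDatum` is the combinatorial parameter
set on which Knapp–Zuckerman's theorems are statements, and the predicates transcribe the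
printed criteria. Other groups (`Sp`, `SO`, general root data with a `θ`-stable structure) and the
`R`-group / basic-character theory of Knapp–Zuckerman are out of scope.

## References

* `KnappZuckerman1982` — A. W. Knapp, G. J. Zuckerman, *Classification of irreducible tempered
  representations of semisimple groups*, Ann. of Math. 116 (1982), Thm. 1.1, §12 (cited through
  the restatement by Carayol–Knapp).
* `CarayolKnapp2007` — H. Carayol, A. W. Knapp, *Limits of discrete series with infinitesimal
  character zero*, Trans. AMS 359 (2007), Introduction and §2 (eq. (2.4)).
* `KnappVogan1995` — A. W. Knapp, D. A. Vogan, *Cohomological induction and unitary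
  representations* (1995), §XI.8, Prop. 11.180 and (11.184).
* `GoldringKoskivirta2019` — W. Goldring, J.-S. Koskivirta, *Strata Hasse invariants, Hecke
  algebras and Galois representations*, Invent. Math. 217 (2019), §2.2.1–2.2.2, Thm. 2.2.1.
* `Goldring2016` — W. Goldring, *An introduction to the Langlands correspondence*, LMS Lecture
  Notes 427 (2016), §3.4.4–3.5.3.
-/

namespace Literature.NumberTheory.Automorphic

variable {p q n : ℕ}

/-- The root `e_x - e_y` (`x ≠ y`) of `(𝔤𝔩_{p+q}(ℂ), 𝔱_ℂ)` is **compact** for `U(p,q)`, i.e. is a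
root of `K = U(p) × U(q)`, iff the coordinates `x, y` lie in the same block (both `e`'s or both
`f`'s); otherwise it is noncompact (Carayol–Knapp 2007, Introduction, the `SU(2,1)` example:
`e₁ - e₂` compact, `e₂ - e₃` noncompact; Goldring 2016, §3.4.4). [cite: CarayolKnapp2007, Introduction] -/
abbrev IsCompactRoot (x y : Fin p ⊕ Fin q) : Prop :=
  x.isLeft = y.isLeft

/-- `IsCompactRoot` is symmetric (the root `e_y - e_x = -(e_x - e_y)` is compact iff `e_x - e_y`
is). [folklore] -/
theorem isCompactRoot_comm (x y : Fin p ⊕ Fin q) : IsCompactRoot x y ↔ IsCompactRoot y x :=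
  eq_comm

/-- **Knapp–Zuckerman data for a discrete series or limit of discrete series of `U(p,q)`.**
A pair `(λ, Ψ)`: `param = λ ∈ 𝔱*` in the coordinates `(e_i | f_j)`, and the positive system
`Ψ = {e_{σ a} - e_{σ b} : a < b}` recorded by the enumeration `order = σ` of the coordinates in
`Ψ`-decreasing order; subject to: `λ` is `Ψ`-dominant (`λ ∘ σ` is antitone) and `λ + ρ_Ψ` is
analytically integral for `T = U(1)^{p+q}`, i.e. every `λ_x ∈ (p+q-1)/2 + ℤ`
(`LDSDatum.exists_int_param_add_rho`). To such data Knapp–Zuckerman attach the representation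
`π(λ, Ψ)` (zero or irreducible tempered); it is NOT required here to be nonzero
(`LDSDatum.IsNonzero`) nor `λ` to be singular (`LDSDatum.IsRegular` = discrete series; Carayol–Knapp
allow discrete series as special cases of limits). Carayol–Knapp 2007, §2; Knapp–Vogan 1995,
§XI.8 (11.179)–(11.184); Goldring–Koskivirta 2019, §2.2.2; Goldring 2016, §3.5.2. [cite: CarayolKnapp2007, §2] -/
structure LDSDatum (p q : ℕ) where
  /-- The Harish-Chandra parameter `λ`: `param (Sum.inl i) = ⟨λ, e_i⟩`,
  `param (Sum.inr j) = ⟨λ, f_j⟩`. -/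
  param : Fin p ⊕ Fin q → ℚ
  /-- The chamber `Ψ`, as the enumeration `σ` of the coordinates in `Ψ`-decreasing order:
  `e_{σ a} - e_{σ b} ∈ Ψ ↔ a < b`. -/
  order : Fin (p + q) ≃ (Fin p ⊕ Fin q)
  /-- `λ` is `Ψ`-dominant: `⟨λ, α⟩ ≥ 0` for all `α ∈ Ψ`. -/
  antitone_param_order : Antitone (param ∘ order)
  /-- `λ + ρ_Ψ` is analytically integral: `λ_x ∈ (p + q - 1)/2 + ℤ` for every coordinate `x`. -/
  exists_int_param : ∀ x, ∃ m : ℤ, param x = m + ((p : ℚ) + q - 1) / 2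

namespace LDSDatum

variable (d : LDSDatum p q)

/-! ### Roots, positivity, `ρ` -/

/-- The root `e_x - e_y` is `Ψ`-positive for the chamber of `d`: `x` is enumerated before `y`.
Carayol–Knapp 2007, §2; Goldring 2016, §3.5.2. [cite: CarayolKnapp2007, §2] -/
abbrev IsPositiveRoot (x y : Fin p ⊕ Fin q) : Prop :=
  d.order.symm x < d.order.symm y

/-- The root `e_x - e_y` is `Ψ`-simple for the chamber of `d`: `y` is enumerated immediately after
`x`. Carayol–Knapp 2007, §2 ((2.4): "C-simple"); Knapp–Vogan 1995, Prop. 11.180. [cite: CarayolKnapp2007, §2 (2.4)] -/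
abbrev IsSimpleRoot (x y : Fin p ⊕ Fin q) : Prop :=
  (d.order.symm y : ℕ) = d.order.symm x + 1

/-- The root `e_x - e_y` (`x ≠ y`) is orthogonal to `λ`: `⟨λ, e_x - e_y⟩ = λ_x - λ_y = 0`.
Goldring 2016, §3.4.4 (regular/singular); Carayol–Knapp 2007, Introduction. [cite: Goldring2016, §3.4.4] -/
abbrev IsOrthogonalRoot (x y : Fin p ⊕ Fin q) : Prop :=
  d.param x = d.param y

/-- `ρ_Ψ`, half the sum of the `Ψ`-positive roots, in coordinates: the `a`-th enumerated
coordinate of `ρ_Ψ` is `(p+q-1)/2 - a`. Knapp–Vogan 1995, §XI.8; Goldring–Koskivirta 2019,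
§2.2.1. [cite: GoldringKoskivirta2019, §2.2.1] -/
def rho (x : Fin p ⊕ Fin q) : ℚ :=
  ((p : ℚ) + q - 1) / 2 - (d.order.symm x : ℕ)

/-- `ρ_Ψ` along the enumeration: `ρ_{σ a} = (p+q-1)/2 - a`. Knapp–Vogan 1995, §XI.8. [cite: KnappVogan1995, §XI.8] -/
@[simp]
theorem rho_order (a : Fin (p + q)) : d.rho (d.order a) = ((p : ℚ) + q - 1) / 2 - (a : ℕ) := by
  simp [rho]

/-- `ρ_Ψ` pairs to `1` with every `Ψ`-simple root: `ρ_x - ρ_y = 1` when `e_x - e_y` is simple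
(all roots of type `A` having the same length, `⟨ρ_Ψ, α^∨⟩ = 1` for `Ψ`-simple `α`).
Knapp–Vogan 1995, §XI.8 (proof of Prop. 11.180). [cite: KnappVogan1995, Prop. 11.180 (proof)] -/
theorem rho_sub_rho_of_isSimpleRoot {x y : Fin p ⊕ Fin q} (h : d.IsSimpleRoot x y) :
    d.rho x - d.rho y = 1 := by
  simp only [rho, h]
  push_cast
  ring

/-- The integrality condition of `LDSDatum` is exactly "`λ + ρ_Ψ` is analytically integral"
(`X*(T) = ℤ^{p+q}` for `T = U(1)^{p+q}`). Carayol–Knapp 2007, §2 ("the representation exists iff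
`e^{λ-ρ}` is well defined as a character of `B`"); Goldring–Koskivirta 2019, §2.2.2
(`λ ∈ X*(T) + ρ`). [cite: CarayolKnapp2007, §2] -/
theorem exists_int_param_add_rho (x : Fin p ⊕ Fin q) : ∃ m : ℤ, d.param x + d.rho x = m := by
  obtain ⟨m, hm⟩ := d.exists_int_param x
  refine ⟨m + p + q - 1 - (d.order.symm x : ℕ), ?_⟩
  rw [hm, rho]
  push_cast
  ring

/-- Conversely, a `Ψ`-dominant `λ` with `λ + ρ_Ψ` analytically integral is an `LDSDatum`: the
integrality field can be supplied in the form `λ_x + ((p+q-1)/2 - a_x) ∈ ℤ`.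
Carayol–Knapp 2007, §2. [cite: CarayolKnapp2007, §2] -/
theorem exists_int_param_of_add_rho (param : Fin p ⊕ Fin q → ℚ)
    (order : Fin (p + q) ≃ (Fin p ⊕ Fin q))
    (h : ∀ x, ∃ m : ℤ, param x + (((p : ℚ) + q - 1) / 2 - (order.symm x : ℕ)) = m)
    (x : Fin p ⊕ Fin q) : ∃ m : ℤ, param x = m + ((p : ℚ) + q - 1) / 2 := by
  obtain ⟨m, hm⟩ := h x
  refine ⟨m + (order.symm x : ℕ) - p - q + 1, ?_⟩
  push_cast
  linear_combination hm

/-- Dominance in root language: `⟨λ, α⟩ ≥ 0`, i.e. `λ_y ≤ λ_x`, for every `Ψ`-positive root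
`α = e_x - e_y`. Knapp–Vogan 1995, (11.179); Goldring–Koskivirta 2019, §2.2.2 (`λ ∈ C̄`). [cite: KnappVogan1995, (11.179)] -/
theorem param_le_param_of_isPositiveRoot {x y : Fin p ⊕ Fin q} (h : d.IsPositiveRoot x y) :
    d.param y ≤ d.param x := by
  have := d.antitone_param_order h.le
  simpa using this

/-! ### Non-vanishing, regularity, (non-)degeneracy -/

/-- **Knapp–Zuckerman non-vanishing criterion.** `π(λ, Ψ) ≠ 0` iff `λ` is orthogonal to no
compact `Ψ`-simple root; we take the criterion as the definition of "the datum is nonzero".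
Carayol–Knapp 2007, (2.4) (sufficiency = Hecht–Schmid identity, necessity = Knapp–Zuckerman 1982,
Thm. 1.1(b)); Knapp–Vogan 1995, Prop. 11.180; Goldring–Koskivirta 2019, §2.2.2; Goldring 2016,
§3.5.2 ("irregular Harish-Chandra parameter"). [cite: CarayolKnapp2007, §2 (2.4)] -/
def IsNonzero (d : LDSDatum p q) : Prop :=
  ∀ ⦃x y : Fin p ⊕ Fin q⦄, d.IsSimpleRoot x y → IsCompactRoot x y → d.param x ≠ d.param y

/-- `λ` is **regular** (orthogonal to no root): `π(λ, Ψ)` is then the discrete series with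
Harish-Chandra parameter `λ` (and `Ψ` is determined by `λ`). Knapp–Vogan 1995, (11.184)/(11.190d);
Goldring 2016, Thm. 3.4.2; Carayol–Knapp 2007, §2. [cite: KnappVogan1995, (11.190d)] -/
def IsRegular (d : LDSDatum p q) : Prop :=
  ∀ ⦃x y : Fin p ⊕ Fin q⦄, x ≠ y → d.param x ≠ d.param y

/-- **Non-degenerate** data (Knapp–Zuckerman): `λ` is orthogonal to NO compact root (simple or
not); equivalently `λ` is regular for `K = U(p) × U(q)`. Degenerate limits are those nonzero
`π(λ, Ψ)` with `λ` orthogonal to some compact (necessarily non-`Ψ`-simple) root.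
Goldring–Koskivirta 2019, §2.2.2; Carayol–Knapp 2007, Introduction and §2 (Knapp–Zuckerman 1982,
§12, real-rank-zero data); Goldring 2016, §3.5.3. [cite: GoldringKoskivirta2019, §2.2.2] -/
def IsNondegenerate (d : LDSDatum p q) : Prop :=
  ∀ ⦃x y : Fin p ⊕ Fin q⦄, x ≠ y → IsCompactRoot x y → d.param x ≠ d.param y

/-- **`π(λ, Ψ)` is a non-degenerate limit of discrete series** (discrete series allowed as the
regular special case, as in Carayol–Knapp 2007, §2): it is nonzero (`IsNonzero`, Knapp–Zuckerman's
criterion) and its data are non-degenerate (`IsNondegenerate`). By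
`isNondegenerateLimitOfDiscreteSeries_iff` the first conjunct is implied by the second. These are
the archimedean components seen by coherent cohomology of Shimura varieties
(Goldring–Koskivirta 2019, Thm. 2.2.1, Schmid–Williams–Harris). Goldring–Koskivirta 2019, §2.2.2;
Goldring 2016, §3.5.3; Carayol–Knapp 2007, Introduction. [cite: GoldringKoskivirta2019, §2.2.2] -/
def IsNondegenerateLimitOfDiscreteSeries (d : LDSDatum p q) : Prop :=
  d.IsNonzero ∧ d.IsNondegenerate

/-- **Degenerate** limit of discrete series: `π(λ, Ψ) ≠ 0` but `λ` is orthogonal to some compact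
root. Goldring–Koskivirta 2019, §2.2.2; Carayol–Knapp 2007, Introduction. [cite: GoldringKoskivirta2019, §2.2.2] -/
def IsDegenerate (d : LDSDatum p q) : Prop :=
  d.IsNonzero ∧ ¬d.IsNondegenerate

/-- Non-vanishing is decidable (finitely many roots, rational coordinates), so concrete data can
be checked by `decide`. [folklore] -/
instance : Decidable d.IsNonzero := by
  unfold IsNonzero; infer_instance

/-- Regularity is decidable. [folklore] -/
instance : Decidable d.IsRegular := by
  unfold IsRegular; infer_instance

/-- Non-degeneracy is decidable. [folklore] -/
instance : Decidable d.IsNondegenerate := by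
  unfold IsNondegenerate; infer_instance

/-- Being a non-degenerate limit of discrete series is decidable. [folklore] -/
instance : Decidable d.IsNondegenerateLimitOfDiscreteSeries := by
  unfold IsNondegenerateLimitOfDiscreteSeries; infer_instance

/-- Degeneracy is decidable. [folklore] -/
instance : Decidable d.IsDegenerate := by
  unfold IsDegenerate; infer_instance

variable {d}

/-- A `Ψ`-simple root `e_x - e_y` has `x ≠ y`. [folklore] -/
theorem IsSimpleRoot.ne {x y : Fin p ⊕ Fin q} (h : d.IsSimpleRoot x y) : x ≠ y := by
  rintro rfl
  simp at h

/-- A `Ψ`-simple root is `Ψ`-positive. Goldring 2016, §3.5.2. [cite: Goldring2016, §3.5.2] -/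
theorem IsSimpleRoot.isPositiveRoot {x y : Fin p ⊕ Fin q} (h : d.IsSimpleRoot x y) :
    d.IsPositiveRoot x y := by
  change d.order.symm x < d.order.symm y
  rw [Fin.lt_def, h]
  exact Nat.lt_succ_self _

/-- Regular data are non-degenerate (a discrete series is a non-degenerate "limit").
Carayol–Knapp 2007, Introduction ("if `λ` is nonsingular with respect to all compact roots, the
classification points to `π(λ, C)` itself"). [cite: CarayolKnapp2007, Introduction] -/
theorem IsRegular.isNondegenerate (h : d.IsRegular) : d.IsNondegenerate :=
  fun _ _ hxy _ ↦ h hxy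

/-- Non-degenerate data are nonzero: a compact simple root orthogonal to `λ` would in particular be
a compact root orthogonal to `λ`. Goldring–Koskivirta 2019, §2.2.2 ("which is then necessarily not
`C`-simple"); Goldring 2016, §3.5.3. [cite: GoldringKoskivirta2019, §2.2.2] -/
theorem IsNondegenerate.isNonzero (h : d.IsNondegenerate) : d.IsNonzero :=
  fun _ _ hs hc ↦ h hs.ne hc

/-- Hence "non-degenerate limit of discrete series" is equivalent to the non-degeneracy of the data
alone. Goldring–Koskivirta 2019, §2.2.2. [cite: GoldringKoskivirta2019, §2.2.2] -/
theorem isNondegenerateLimitOfDiscreteSeries_iff :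
    d.IsNondegenerateLimitOfDiscreteSeries ↔ d.IsNondegenerate :=
  ⟨fun h ↦ h.2, fun h ↦ ⟨h.isNonzero, h⟩⟩

/-- Discrete series are non-degenerate limits of discrete series (in the inclusive convention).
Carayol–Knapp 2007, §2. [cite: CarayolKnapp2007, §2] -/
theorem IsRegular.isNondegenerateLimitOfDiscreteSeries (h : d.IsRegular) :
    d.IsNondegenerateLimitOfDiscreteSeries :=
  isNondegenerateLimitOfDiscreteSeries_iff.2 h.isNondegenerate

/-- A nonzero datum is either non-degenerate or degenerate (the Knapp–Zuckerman dichotomy).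
Goldring–Koskivirta 2019, §2.2.2. [cite: GoldringKoskivirta2019, §2.2.2] -/
theorem IsNonzero.isNondegenerateLimitOfDiscreteSeries_or_isDegenerate (h : d.IsNonzero) :
    d.IsNondegenerateLimitOfDiscreteSeries ∨ d.IsDegenerate := by
  by_cases hnd : d.IsNondegenerate
  · exact Or.inl ⟨h, hnd⟩
  · exact Or.inr ⟨h, hnd⟩

/-- Regularity is injectivity of the coordinate function `λ`. [folklore] -/
theorem isRegular_iff_injective : d.IsRegular ↔ Function.Injective d.param :=
  ⟨fun h _ _ hxy ↦ by_contra fun hne ↦ h hne hxy, fun h _ _ hne hxy ↦ hne (h hxy)⟩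

/-- Non-degeneracy says: `λ` is injective on the `e`-block and on the `f`-block separately
(`λ` is regular for `K = U(p) × U(q)`). Goldring–Koskivirta 2019, Thm. 2.2.1 ("normalized by
requiring that `λ` be `Δ_c^∨`-dominant and regular"). [cite: GoldringKoskivirta2019, Thm. 2.2.1] -/
theorem isNondegenerate_iff_injective :
    d.IsNondegenerate ↔
      Function.Injective (d.param ∘ Sum.inl) ∧ Function.Injective (d.param ∘ Sum.inr) := by
  constructor
  · intro h
    refine ⟨fun i j hij ↦ ?_, fun i j hij ↦ ?_⟩
    · by_contra hne
      exact h (x := Sum.inl i) (y := Sum.inl j) (fun e ↦ hne (Sum.inl_injective e)) rfl hij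
    · by_contra hne
      exact h (x := Sum.inr i) (y := Sum.inr j) (fun e ↦ hne (Sum.inr_injective e)) rfl hij
  · rintro ⟨hl, hr⟩ x y hne hc hxy
    cases x with
    | inl i =>
      cases y with
      | inl j => exact hne (congrArg Sum.inl (hl hxy))
      | inr j => simp [IsCompactRoot] at hc
    | inr i =>
      cases y with
      | inl j => simp [IsCompactRoot] at hc
      | inr j => exact hne (congrArg Sum.inr (hr hxy))

/-! ### Parity of the parameter: `λ_x ∈ (p+q-1)/2 + ℤ` -/

/-- If `p + q` is even, every coordinate of the Harish-Chandra parameter of a discrete series or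
limit of discrete series of `U(p,q)` lies in `1/2 + ℤ`. Goldring–Koskivirta 2019, §2.2.1–2.2.2
(`λ ∈ X*(T) + ρ`, "C-algebraic"); Carayol–Knapp 2007, §2. [cite: GoldringKoskivirta2019, §2.2.2] -/
theorem exists_param_eq_intCast_add_half (hN : Even (p + q)) (x : Fin p ⊕ Fin q) :
    ∃ m : ℤ, d.param x = m + 1 / 2 := by
  obtain ⟨r, hr⟩ := hN
  obtain ⟨m, hm⟩ := d.exists_int_param x
  refine ⟨m + r - 1, ?_⟩
  have hr' : ((p : ℚ) + q) = r + r := by exact_mod_cast hr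
  rw [hm, hr']
  push_cast
  ring

/-- In particular (`p + q` even) NO coordinate of such a parameter is an integer: no discrete
series or limit of discrete series of `U(p,q)`, `p + q = 2n`, has an integral entry in its
infinitesimal character — the dichotomy "limit of discrete series with parameter in `1/2 + ℤ`
versus unitary principal series with integral infinitesimal character" of route
`Langlands/QuadraticWindow`. Goldring–Koskivirta 2019, §2.2.2; Carayol–Knapp 2007, §2. [cite: GoldringKoskivirta2019, §2.2.2] -/
theorem param_ne_intCast (hN : Even (p + q)) (x : Fin p ⊕ Fin q) (m : ℤ) : d.param x ≠ m := by
  obtain ⟨k, hk⟩ := d.exists_param_eq_intCast_add_half hN x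
  intro h
  rw [h] at hk
  have h2 : (2 * m : ℚ) = 2 * k + 1 := by linear_combination 2 * hk
  have h3 : (2 * m : ℤ) = 2 * k + 1 := by exact_mod_cast h2
  omega

/-- If `p + q` is odd, every coordinate of the parameter is an integer.
Goldring–Koskivirta 2019, §2.2.1–2.2.2. [cite: GoldringKoskivirta2019, §2.2.2] -/
theorem exists_param_eq_intCast (hN : Odd (p + q)) (x : Fin p ⊕ Fin q) :
    ∃ m : ℤ, d.param x = m := by
  obtain ⟨r, hr⟩ := hN
  obtain ⟨m, hm⟩ := d.exists_int_param x
  refine ⟨m + r, ?_⟩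
  have hr' : ((p : ℚ) + q) = 2 * r + 1 := by exact_mod_cast hr
  rw [hm, hr']
  push_cast
  ring

/-! ### Infinitesimal character -/

variable (d)

/-- The **infinitesimal character** of `π(λ, Ψ)`: under the Harish-Chandra isomorphism it is the
`W = S_{p+q}`-orbit of `λ`, i.e. the multiset of the `p + q` coordinates of `λ`, viewed in `ℂ`.
This is the format (`Multiset ℂ` of cardinality `p + q`) in which
`Literature.NumberTheory.Automorphic.HasHCParameter` / `HasArchParameter` (and the `a`-exponents of
an `InfinityType`) record Harish-Chandra parameters of `𝔤𝔩_{p+q}`-modules.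
Knapp–Vogan 1995, (11.184d); Goldring 2016, Thm. 3.5.1; Goldring–Koskivirta 2019, §2.2.1–2.2.2. [cite: KnappVogan1995, (11.184d)] -/
def infChar : Multiset ℂ :=
  Finset.univ.val.map fun x ↦ ((d.param x : ℚ) : ℂ)

/-- The infinitesimal character has `p + q` entries. Knapp–Vogan 1995, (11.184d). [cite: KnappVogan1995, (11.184d)] -/
@[simp]
theorem card_infChar : Multiset.card d.infChar = p + q := by
  simp [infChar]

/-- Membership in the infinitesimal character. Knapp–Vogan 1995, (11.184d). [cite: KnappVogan1995, (11.184d)] -/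
theorem mem_infChar_iff {z : ℂ} : z ∈ d.infChar ↔ ∃ x, ((d.param x : ℚ) : ℂ) = z := by
  simp [infChar]

/-- Every entry of the infinitesimal character lies in `(p+q-1)/2 + ℤ`; in Buzzard–Gee's
terminology (cf. `InfinityType.IsCAlgebraic`, exponents in `(n-1)/2 + ℤ` for `GL_n`) limits of
discrete series are `C`-algebraic. Goldring–Koskivirta 2019, §2.2.1–2.2.2. [cite: GoldringKoskivirta2019, §2.2.1] -/
theorem exists_eq_of_mem_infChar {z : ℂ} (hz : z ∈ d.infChar) :
    ∃ m : ℤ, z = m + ((p : ℂ) + q - 1) / 2 := by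
  obtain ⟨x, rfl⟩ := d.mem_infChar_iff.1 hz
  obtain ⟨m, hm⟩ := d.exists_int_param x
  exact ⟨m, by rw [hm]; push_cast; ring⟩

/-! ### Equivalences: conjugation by the compact Weyl group `W_K = S_p × S_q` -/

/-- `(λ', Ψ')` is `W_K`-conjugate to `(λ, Ψ)`: there is a block-preserving permutation `w` of the
coordinates (`W_K = W(U(p) × U(q), T) = S_p × S_q`) with `λ' = λ ∘ w⁻¹` and `σ' = w ∘ σ`. For
nonzero data this is exactly the condition `π(λ, Ψ) ≅ π(λ', Ψ')` (Knapp–Zuckerman 1982,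
Thm. 1.1(c), as restated in Carayol–Knapp 2007, §2; Knapp–Vogan 1995, (11.184e); Goldring 2016,
Thm. 3.5.1). [cite: CarayolKnapp2007, §2] -/
def IsKConjugate (d d' : LDSDatum p q) : Prop :=
  ∃ w : Equiv.Perm (Fin p ⊕ Fin q), (∀ x, (w x).isLeft = x.isLeft) ∧
    d'.param = d.param ∘ w.symm ∧ d'.order = d.order.trans w

/-- `W_K`-conjugacy is reflexive. [folklore] -/
theorem IsKConjugate.refl (d : LDSDatum p q) : d.IsKConjugate d :=
  ⟨Equiv.refl _, fun _ ↦ rfl, rfl, by ext; rfl⟩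

/-- `W_K`-conjugacy is symmetric. [folklore] -/
theorem IsKConjugate.symm {d d' : LDSDatum p q} (h : d.IsKConjugate d') : d'.IsKConjugate d := by
  obtain ⟨w, hw, hparam, horder⟩ := h
  refine ⟨w.symm, fun x ↦ ?_, ?_, ?_⟩
  · simpa using (hw (w.symm x)).symm
  · rw [hparam]
    ext x
    simp
  · rw [horder]
    ext x
    simp

/-- `W_K`-conjugacy is transitive. [folklore] -/
theorem IsKConjugate.trans {d d' d'' : LDSDatum p q} (h : d.IsKConjugate d')
    (h' : d'.IsKConjugate d'') : d.IsKConjugate d'' := by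
  obtain ⟨w, hw, hparam, horder⟩ := h
  obtain ⟨w', hw', hparam', horder'⟩ := h'
  refine ⟨w.trans w', fun x ↦ by simp [hw, hw'], ?_, ?_⟩
  · rw [hparam', hparam]
    ext x
    simp
  · rw [horder', horder]
    ext x
    simp

/-! ### Holomorphic chambers -/

/-- The chamber `Ψ` is **holomorphic** for the standard complex structure on `U(p,q)/K`
(`𝔭⁺` spanned by the root vectors of the `e_i - f_j`): every noncompact positive root is of the
form `e_i - f_j`, i.e. all `e`-coordinates are enumerated before all `f`-coordinates. (The
holomorphic chambers for the opposite complex structure are those with all `f`'s first.)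
Goldring 2016, §3.4.5 and §3.5.3; Goldring–Koskivirta 2019, §2.2.2 (`X`-holomorphic). [cite: Goldring2016, §3.5.3] -/
def IsHolomorphic (d : LDSDatum p q) : Prop :=
  ∀ ⦃a b : Fin (p + q)⦄, (d.order a).isLeft = true → (d.order b).isLeft = false → a < b

/-- Holomorphy of the chamber is decidable. [folklore] -/
instance : Decidable d.IsHolomorphic := by
  unfold IsHolomorphic; infer_instance

variable {d}

/-- Along an antitone sequence, equal values at `a ≤ b` force equal values at `a` and `a + 1 ≤ b`.
[folklore] -/
private theorem eq_succ_of_antitone {N : ℕ} {f : Fin N → ℚ} (hf : Antitone f) {a b : Fin N}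
    (hab : a < b) (h : f a = f b) (c : Fin N) (hc : (c : ℕ) = a + 1) : f a = f c := by
  have hac : a ≤ c := by rw [Fin.le_iff_val_le_val, hc]; exact Nat.le_succ _
  have hcb : c ≤ b := by
    rw [Fin.le_iff_val_le_val, hc]
    exact Nat.succ_le_of_lt (Fin.lt_def.1 hab)
  exact le_antisymm (h ▸ hf hcb) (hf hac)

/-- **A nonzero holomorphic limit of discrete series is non-degenerate** (for `U(p,q)`): if `λ`
were orthogonal to a compact root `e_x - e_y`, say with `x` enumerated before `y`, then by
dominance `λ` is constant on the enumerated segment from `x` to `y`, which by holomorphy stays in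
one block, so `λ` is orthogonal to the compact simple root starting at `x`, contradicting
non-vanishing. Goldring 2016, §3.5.3 ("A holomorphic limit of discrete series is necessarily
non-degenerate"); Goldring–Koskivirta 2019, §2.2.2. [cite: Goldring2016, §3.5.3] -/
theorem IsHolomorphic.isNondegenerate (hhol : d.IsHolomorphic) (hnz : d.IsNonzero) :
    d.IsNondegenerate := by
  -- reduce to enumerated positions `a < b` in the same block with equal values
  suffices key : ∀ a b : Fin (p + q), a < b → (d.order a).isLeft = (d.order b).isLeft →
      d.param (d.order a) ≠ d.param (d.order b) by
    intro x y hne hc hxy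
    obtain ⟨a, rfl⟩ := d.order.surjective x
    obtain ⟨b, rfl⟩ := d.order.surjective y
    rcases lt_trichotomy a b with hab | rfl | hab
    · exact key a b hab hc hxy
    · exact hne rfl
    · exact key b a hab hc.symm hxy.symm
  intro a b hab hc hxy
  -- the successor position `c = a + 1`
  have hlt : (a : ℕ) + 1 < p + q := lt_of_le_of_lt (Nat.succ_le_of_lt (Fin.lt_def.1 hab)) b.2
  set c : Fin (p + q) := ⟨a + 1, hlt⟩ with hc_def
  have hcval : (c : ℕ) = a + 1 := rfl
  have hcb : c ≤ b := by
    rw [Fin.le_iff_val_le_val, hcval]; exact Nat.succ_le_of_lt (Fin.lt_def.1 hab)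
  -- `λ` takes the same value at `a` and `c`
  have hac : d.param (d.order a) = d.param (d.order c) :=
    eq_succ_of_antitone d.antitone_param_order hab hxy c hcval
  -- `c` lies in the same block as `a` (holomorphy: each block is an order-segment)
  have hblock : (d.order a).isLeft = (d.order c).isLeft := by
    cases ha : (d.order a).isLeft with
    | true =>
      -- `b` is in the `e`-block and `c ≤ b`, so `c` cannot be in the `f`-block
      by_contra hcf
      have hcf' : (d.order c).isLeft = false := by simpa using (Ne.symm hcf)
      have hb : (d.order b).isLeft = true := by rw [← hc, ha]
      exact absurd (hhol hb hcf') (not_lt.2 hcb)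
    | false =>
      by_contra hct
      have hct' : (d.order c).isLeft = true := by simpa using (Ne.symm hct)
      have := hhol hct' ha
      exact absurd this (not_lt.2 (Fin.le_iff_val_le_val.2 (by rw [hcval]; exact Nat.le_succ _)))
  -- contradiction with non-vanishing at the simple root `e_{σ a} - e_{σ c}`
  refine hnz ?_ hblock hac
  change (d.order.symm (d.order c) : ℕ) = d.order.symm (d.order a) + 1
  simp [hcval]

/-! ### The `U(n,n)` data `(k | k)` -/

/-- The block index of a coordinate of `U(n,n)`: `e_t ↦ t`, `f_t ↦ t`. [folklore] -/
def twinIndex : Fin n ⊕ Fin n → Fin n :=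
  Sum.elim id id

/-- `twinIndex (e_t) = t`. [folklore] -/
@[simp]
theorem twinIndex_inl (t : Fin n) : twinIndex (Sum.inl t) = t := rfl

/-- `twinIndex (f_t) = t`. [folklore] -/
@[simp]
theorem twinIndex_inr (t : Fin n) : twinIndex (Sum.inr t) = t := rfl

/-- Interleaving bijection `Fin n × Fin 2 ≃ Fin n ⊕ Fin n` used to enumerate the coordinates of
`U(n,n)` as `…, e_t, f_t, …` (`ε t = false`) or `…, f_t, e_t, …` (`ε t = true`). [folklore] -/
def twinMix (ε : Fin n → Bool) : Fin n × Fin 2 ≃ (Fin n ⊕ Fin n) where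
  toFun x := if ε x.1 then (if x.2 = 0 then Sum.inr x.1 else Sum.inl x.1)
    else (if x.2 = 0 then Sum.inl x.1 else Sum.inr x.1)
  invFun := Sum.elim (fun t ↦ (t, if ε t then 1 else 0)) (fun t ↦ (t, if ε t then 0 else 1))
  left_inv := by
    rintro ⟨t, j⟩
    fin_cases j <;> cases h : ε t <;> simp [h]
  right_inv := by
    rintro (t | t) <;> cases h : ε t <;> simp [h]

/-- The block index of `twinMix ε x` is `x.1`. [folklore] -/
@[simp]
theorem twinIndex_twinMix (ε : Fin n → Bool) (x : Fin n × Fin 2) :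
    twinIndex (twinMix ε x) = x.1 := by
  obtain ⟨t, j⟩ := x
  by_cases h : ε t <;> by_cases hj : j = 0 <;> simp [twinMix, twinIndex, h, hj]

/-- `2^n` chambers of `U(n,n)` containing `(k | k)` (`k` strictly decreasing) in their closure
(in fact all of them): enumerate the coordinates pair by pair, `{e_0, f_0}, {e_1, f_1}, …`, taking
`e_t` before `f_t` iff `ε t = false`; position `2t + j ↦ e_t / f_t`. Goldring 2016, §3.5.2
(chambers = positive systems); Carayol–Knapp 2007, Introduction (`U(n,n)`). [cite: Goldring2016, §3.5.2] -/
def twinOrder (ε : Fin n → Bool) : Fin (n + n) ≃ (Fin n ⊕ Fin n) :=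
  ((finCongr (mul_two n)).symm.trans finProdFinEquiv.symm).trans (twinMix ε)

/-- The block index of the `a`-th enumerated coordinate is `a / 2`. [folklore] -/
@[simp]
theorem coe_twinIndex_twinOrder (ε : Fin n → Bool) (a : Fin (n + n)) :
    ((twinIndex (twinOrder ε a) : Fin n) : ℕ) = a / 2 := by
  simp [twinOrder]

/-- `Sum.elim k k` factors through the block index. [folklore] -/
theorem sum_elim_eq_comp_twinIndex (k : Fin n → ℚ) : Sum.elim k k = k ∘ twinIndex := by
  funext x
  cases x <;> rfl

/-- **The `U(n,n)` datum with Harish-Chandra parameter `(k₁,…,k_n | k₁,…,k_n)`**, `k` strictly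
decreasing with entries in `1/2 + ℤ` (so that `λ + ρ` is integral, `p + q = 2n`), and chamber
`twinOrder ε`. It is the Harish-Chandra parameter which route `Langlands/QuadraticWindow` (crux
`SignLaw`) predicts, at a real place, for the descent to the quasi-split unitary group `U(n,n)` of
a conjugate self-dual representation with doubled exponents `2·(z/z̄)^{k_i}` (a prediction of the
route, not asserted here). Carayol–Knapp 2007, Introduction (`U(n,n)`); Goldring–Koskivirta 2019,
§2.2.2. [cite: GoldringKoskivirta2019, §2.2.2] -/
def twinDatum (k : Fin n → ℚ) (hk : StrictAnti k) (hhalf : ∀ t, ∃ m : ℤ, k t = m + 1 / 2)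
    (ε : Fin n → Bool) : LDSDatum n n where
  param := Sum.elim k k
  order := twinOrder ε
  antitone_param_order := by
    intro a b hab
    change Sum.elim k k (twinOrder ε b) ≤ Sum.elim k k (twinOrder ε a)
    rw [sum_elim_eq_comp_twinIndex]
    apply hk.antitone
    rw [Fin.le_iff_val_le_val, coe_twinIndex_twinOrder, coe_twinIndex_twinOrder]
    exact Nat.div_le_div_right hab
  exists_int_param := by
    intro x
    obtain ⟨m, hm⟩ := hhalf (twinIndex x)
    refine ⟨m - n + 1, ?_⟩
    rw [sum_elim_eq_comp_twinIndex, Function.comp_apply, hm]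
    push_cast
    ring

section twin

variable (k : Fin n → ℚ) (hk : StrictAnti k) (hhalf : ∀ t, ∃ m : ℤ, k t = m + 1 / 2)
  (ε : Fin n → Bool)

/-- `⟨(k | k), e_t⟩ = k_t`. [folklore] -/
@[simp]
theorem twinDatum_param_inl (t : Fin n) : (twinDatum k hk hhalf ε).param (Sum.inl t) = k t := rfl

/-- `⟨(k | k), f_t⟩ = k_t`. [folklore] -/
@[simp]
theorem twinDatum_param_inr (t : Fin n) : (twinDatum k hk hhalf ε).param (Sum.inr t) = k t := rfl

/-- The parameter of `twinDatum` is `k ∘ twinIndex`. [folklore] -/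
theorem twinDatum_param_apply (x : Fin n ⊕ Fin n) :
    (twinDatum k hk hhalf ε).param x = k (twinIndex x) := by
  change Sum.elim k k x = _
  rw [sum_elim_eq_comp_twinIndex]
  rfl

/-- The chamber of `twinDatum k hk hhalf ε` is `twinOrder ε`. [folklore] -/
@[simp]
theorem twinDatum_order : (twinDatum k hk hhalf ε).order = twinOrder ε := rfl

/-- **The roots orthogonal to `(k | k)` are exactly the noncompact roots `±(e_t - f_t)`:**
`λ_x = λ_y` iff `x, y` have the same block index. Carayol–Knapp 2007, Introduction (`U(n,n)`);
Goldring–Koskivirta 2019, §2.2.2. [cite: GoldringKoskivirta2019, §2.2.2] -/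
theorem twinDatum_param_eq_iff (x y : Fin n ⊕ Fin n) :
    (twinDatum k hk hhalf ε).param x = (twinDatum k hk hhalf ε).param y ↔
      twinIndex x = twinIndex y := by
  rw [twinDatum_param_apply, twinDatum_param_apply]
  exact hk.injective.eq_iff

/-- In particular every root orthogonal to `(k | k)` is NONCOMPACT (and joins `e_t` to `f_t`).
Goldring–Koskivirta 2019, §2.2.2. [cite: GoldringKoskivirta2019, §2.2.2] -/
theorem not_isCompactRoot_of_twinDatum_param_eq {x y : Fin n ⊕ Fin n} (hxy : x ≠ y)
    (h : (twinDatum k hk hhalf ε).param x = (twinDatum k hk hhalf ε).param y) :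
    ¬IsCompactRoot x y ∧ twinIndex x = twinIndex y := by
  have hidx := (twinDatum_param_eq_iff k hk hhalf ε x y).1 h
  refine ⟨fun hc ↦ hxy ?_, hidx⟩
  cases x with
  | inl s =>
    cases y with
    | inl t => exact congrArg Sum.inl (by simpa using hidx)
    | inr t => simp [IsCompactRoot] at hc
  | inr s =>
    cases y with
    | inl t => simp [IsCompactRoot] at hc
    | inr t => exact congrArg Sum.inr (by simpa using hidx)

/-- Conversely the noncompact roots `e_t - f_t` ARE orthogonal to `(k | k)`. [folklore] -/
theorem twinDatum_param_inl_eq_param_inr (t : Fin n) :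
    (twinDatum k hk hhalf ε).param (Sum.inl t) = (twinDatum k hk hhalf ε).param (Sum.inr t) := rfl

/-- **`(k | k)` carries non-degenerate data for every one of its `2^n` chambers.**
Goldring–Koskivirta 2019, §2.2.2; Carayol–Knapp 2007, Introduction. [cite: GoldringKoskivirta2019, §2.2.2] -/
theorem isNondegenerate_twinDatum : (twinDatum k hk hhalf ε).IsNondegenerate :=
  fun _ _ hxy hc h ↦ (not_isCompactRoot_of_twinDatum_param_eq k hk hhalf ε hxy h).1 hc

/-- **`π((k | k), Ψ_ε)` is a non-degenerate limit of discrete series of `U(n,n)`** for every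
`ε : Fin n → Bool` — the statement consumed by route `Langlands/QuadraticWindow` (crux `SignLaw`).
Goldring–Koskivirta 2019, §2.2.2 with Knapp–Zuckerman's criteria (Carayol–Knapp 2007, §2). [cite: GoldringKoskivirta2019, §2.2.2] -/
theorem isNondegenerateLimitOfDiscreteSeries_twinDatum :
    (twinDatum k hk hhalf ε).IsNondegenerateLimitOfDiscreteSeries :=
  isNondegenerateLimitOfDiscreteSeries_iff.2 (isNondegenerate_twinDatum k hk hhalf ε)

/-- … and it is a PROPER limit (not a discrete series) as soon as `n ≥ 1`: `λ` is orthogonal to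
`e_0 - f_0`. Goldring–Koskivirta 2019, §2.2.2. [cite: GoldringKoskivirta2019, §2.2.2] -/
theorem not_isRegular_twinDatum (hn : 0 < n) : ¬(twinDatum k hk hhalf ε).IsRegular := by
  intro h
  exact h (x := Sum.inl ⟨0, hn⟩) (y := Sum.inr ⟨0, hn⟩) (by simp) rfl

/-- Every coordinate of `(k | k)` is a non-integer (half-integral): the case `p + q = 2n` of
`LDSDatum.param_ne_intCast`. Goldring–Koskivirta 2019, §2.2.2. [cite: GoldringKoskivirta2019, §2.2.2] -/
theorem twinDatum_param_ne_intCast (x : Fin n ⊕ Fin n) (m : ℤ) :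
    (twinDatum k hk hhalf ε).param x ≠ m :=
  (twinDatum k hk hhalf ε).param_ne_intCast (p := n) (q := n) ⟨n, rfl⟩ x m

end twin

end LDSDatum

end Literature.NumberTheory.Automorphic
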